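import Literature.AlgebraicGeometry.HodgeTheory.CoveringHodgeConjecture
import Literature.AlgebraicGeometry.HodgeTheory.HodgeClassesBlowupBirationalInvarianceProofs
import Summits.HodgeConjecture.HodgeConjecture.Theorems.BoundaryReadoutPullbackAlgebraic
import HarnessLib

/-!
# HC under Lefschetz-type packages — zero loci of sections of AMPLE bundles (Sommese), the k-ample ∕ sub-middle WINDOW, and the `hFul`-free forms of CL-LEF1 ∕ CL-LEF2 ∕ L7

One module (Sketch §B + §C, ll. 63–233). §B — ZL rows as CONSUMERS of a Sommese package (`ι^*` bijective below the middle): `hodgeConjectureFor_of_sommesePackage_odd`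
(ZL-A), `…_even` (ZL-B, with the Noether–Lefschetz hypothesis `hNL`), `…_projectiveSpace_even` (ZL-B(ℙᴺ), the Spandaw Thm. 4 shape, ambient HC from the tree),
`…_of_kAmplePackage` (ZL-W), `…_of_subMiddleWindow_odd` (ZL-odd⁻). §C — the tree rows with `hFul : fulton1998_map_mem_algebraicClasses` DISCHARGED by
`Theorems.fulton1998_map_mem_algebraicClasses_holds`: `hodgeConjectureFor_hypersurfaceSection_of_odd'` (CL-LEF1: HC(X) ⇒ HC(X ∩ V₊(F)) for smooth odd-dimensional
hypersurface sections, any degree, any embedding), `…_twoStep'`, `…_of_middle_mem_range'` (CL-LEF2), `veryGeneralSection_hodgeConjectureFor'` (L7),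
`hodgeConjectureFor_of_sommesePackage_odd'`, `…_projectiveSpace_even'`, `hodgeConjectureFor_of_coverWindow'` (window core, unconditional).

PROVENANCE. Cell hodge-nonav (HUMAN RULING D-0038), planner seat p1 g18: chapter ROUTE-P1Q (memo `HOME/memos/ROUTE-P1Q.md` §3.13 rows ZL-A, ZL-B,
ZL-B(ℙᴺ), ZL-W, ZL-odd⁻ and the `hFul`-discharged rows CL-LEF1 ∕ CL-LEF2 ∕ L7), frozen Sketch `HOME/p1/route/Sketch_P1Q_g18.lean` (sha16 eb16687efca8117a,
238 lines, namespace `HodgeNonAV.P1Q`, farm rc 0 / 0 sorries, re-elaborated 2026-08-28), renamed into the tree namespace by planner p1 g34 (landing kit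
HOME/p1/landing/); bodies verbatim. Land with `--supports stmt-HodgeConjecture-19654 --as helper` (SectorComplement evidence: Lefschetz-type sectors).
Everything is PROVED from tree theorems (`HypersurfaceSectionHC.hodgeConjectureFor_of_lefschetzPackage_odd/_even` p509185, `CoveringHC.hodgeConjectureFor_of_coverWindow`
p511152, `hodgeConjectureFor_projectiveSpace` p505778, `Theorems.fulton1998_map_mem_algebraicClasses_holds`); the Sommese ∕ Noether–Lefschetz packages enter as
HYPOTHESES (`hSom`, `hNL`) because the tree has no carrier for zero schemes of sections of vector bundles of rank ≥ 2. No new fact, no instance, no notation, no sorry.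
HONEST SCOPE: inheritance statements HC(X) ⇒ HC(Y) under Lefschetz-type packages; NOTHING here proves the Hodge conjecture.
References: Lazarsfeld, *Positivity in Algebraic Geometry* II (2004) Thm. 7.1.1, Ex. 7.1.5, Rem. 7.1.8–7.1.9 [cite: Lazarsfeld2004PositivityII, Thm. 7.1.1];
A. J. Sommese, Math. Ann. 233 (1978) Prop. 1.16; J. Spandaw, Manuscripta Math. 89 (1996) Thm. 1, 2, 4 (doi:10.1007/bf02567520); O. Debarre, Bull. SMF 128 (2000)
Thm. 2.2; [cite: Voisin2013HodgeLociSurvey, §4.3]; [cite: VoisinHodgeII2003, Thm. 1.23]; [cite: Fulton1998, Cor. 19.2].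
-/

set_option linter.dupNamespace false

noncomputable section

namespace Summit.HodgeConjecture.HodgeConjecture.Theorems.LefschetzPackages

open CategoryTheory AlgebraicGeometry Filter
open Literature.AlgebraicGeometry.Motives
open Literature.AlgebraicGeometry.HodgeTheory
open Literature.AlgebraicGeometry.HodgeTheory.HypersurfaceSectionHC
open Literature.AlgebraicGeometry.HodgeTheory.CoveringHC
open Literature.AlgebraicTopology.SingularHomology


/-! ### §A Cores = tree theorems (`CoveringHC.hodgeConjectureFor_of_coverWindow`,
`HypersurfaceSectionHC.hodgeConjectureFor_of_lefschetzPackage_odd/_even`); nothing re-derived. -/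

/-! ### §B Chapter ZL: consumers of a Sommese package -/

/-- **ROW ZL-A (odd-dimensional zero loci).** `ι : Y ⟶ X` smooth projective, `dim Y = m` ODD, with
the SOMMESE PACKAGE `ι^* : Hⁱ(X) → Hⁱ(Y)` bijective for all `i < m` (Positivity II Thm. 7.1.1 for
`Y = Zeroes(s)`, `s ∈ Γ(X, E)`, `E` ample of rank `n - m`, `Y` smooth of dimension `m`); then
HC(X) ⇒ HC(Y). Instances (memo §3.13): odd-dimensional smooth zero loci of ample bundles on
`ℙⁿ`, on Grassmannians / flag varieties (mod F-CELL), on HC-fourfolds × ℙʳ, on abelian varieties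
with HC. -/
theorem hodgeConjectureFor_of_sommesePackage_odd (hFul : fulton1998_map_mem_algebraicClasses)
    {m n : ℕ} {X Y : SchemeOver ℂ} (hX : IsSmoothProjective n X) (hY : IsSmoothProjective m Y)
    (ι : Y ⟶ X) (hm : Odd m)
    (hSom : ∀ i : ℕ, i < m → Function.Bijective (complexBetti.map ι i))
    (hXHC : HodgeConjectureFor n X) : HodgeConjectureFor m Y :=
  hodgeConjectureFor_of_lefschetzPackage_odd hFul hX hY ι hm (fun p hp ↦ hSom (2 * p) hp)
    (fun p _ c₀ h₁ h₂ ↦ hXHC.2 p c₀ h₁ h₂)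

/-- **ROW ZL-B (even-dimensional zero loci, Noether–Lefschetz form).** `dim Y = 2k`, Sommese
package below `2k` and injectivity on `H²ᵏ` (Thm. 7.1.1: injective for `i = n - e`), plus the
NOETHER–LEFSCHETZ hypothesis `hNL`: every rational `(k,k)` class of `Y` is a restriction from `X`
(Spandaw 1996 Thm. 4 for `X = ℙⁿ`, `E` `(-3)`-regular, `s` general; Mem. AMS 764 for degeneracy
loci); then HC(X) ⇒ HC(Y). -/
theorem hodgeConjectureFor_of_sommesePackage_even (hFul : fulton1998_map_mem_algebraicClasses)
    {k n : ℕ} {X Y : SchemeOver ℂ} (hX : IsSmoothProjective n X) (hY : IsSmoothProjective (2 * k) Y)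
    (ι : Y ⟶ X)
    (hSom : ∀ i : ℕ, i < 2 * k → Function.Bijective (complexBetti.map ι i))
    (hinj : Function.Injective (complexBetti.map ι (2 * k)))
    (hNL : ∀ c : complexBetti Y (2 * k), IsRationalClass c → IsOfHodgeType (2 * k) Y (2 * k) k k c →
      c ∈ LinearMap.range (complexBetti.map ι (2 * k)).hom)
    (hXHC : HodgeConjectureFor n X) : HodgeConjectureFor (2 * k) Y :=
  hodgeConjectureFor_of_lefschetzPackage_even hFul hX hY ι (fun p hp ↦ hSom (2 * p) hp) hinj hNL
    (fun p _ c₀ h₁ h₂ ↦ hXHC.2 p c₀ h₁ h₂)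

/-- **ROW ZL-B(ℙᴺ) (the Spandaw shape, unconditional in the ambient).** A smooth projective `Y` of
dimension `2k` with a morphism `ι : Y ⟶ ℙᴺ_ℂ` such that `ι^*` is bijective below `2k`, injective on
`H²ᵏ`, and every rational `(k,k)` class of `Y` is a restriction (Spandaw Thm. 4: the GENERAL zero
locus of a `(-3)`-regular bundle of rank `N - 2k` on `ℙᴺ`), satisfies the Hodge conjecture: all its
Hodge classes are restricted powers of the hyperplane class and their hard-Lefschetz images. -/
theorem hodgeConjectureFor_of_sommesePackage_projectiveSpace_even
    (hFul : fulton1998_map_mem_algebraicClasses)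
    {k N : ℕ} {Y : SchemeOver ℂ} (hY : IsSmoothProjective (2 * k) Y) (ι : Y ⟶ projectiveSpace N ℂ)
    (hSom : ∀ i : ℕ, i < 2 * k → Function.Bijective (complexBetti.map ι i))
    (hinj : Function.Injective (complexBetti.map ι (2 * k)))
    (hNL : ∀ c : complexBetti Y (2 * k), IsRationalClass c → IsOfHodgeType (2 * k) Y (2 * k) k k c →
      c ∈ LinearMap.range (complexBetti.map ι (2 * k)).hom) :
    HodgeConjectureFor (2 * k) Y :=
  hodgeConjectureFor_of_sommesePackage_even hFul (isSmoothProjective_projectiveSpace_holds ℂ N) hY ι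
    hSom hinj hNL (hodgeConjectureFor_projectiveSpace N)

/-- **ROW ZL-W (k-ample window; Positivity II Rem. 7.1.9 = Sommese Prop. 1.16).** `E` k-ample:
`ι^*` bijective for `i + k < m` only; HC(X) and the algebraicity of the rational `(p,p)` classes of
`Y` in the window `m - k ≤ 2p ≤ m` give HC(Y) (above the middle: hard Lefschetz on `Y`). Same shape
as the P1P cover window COV-W (Lazarsfeld–Barth range), with `w = k + 1`. -/
theorem hodgeConjectureFor_of_kAmplePackage (hFul : fulton1998_map_mem_algebraicClasses)
    {m n k : ℕ} {X Y : SchemeOver ℂ} (hX : IsSmoothProjective n X) (hY : IsSmoothProjective m Y)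
    (ι : Y ⟶ X)
    (hSom : ∀ i : ℕ, i + k < m → Function.Bijective (complexBetti.map ι i))
    (hwin : ∀ p : ℕ, m ≤ 2 * p + k → 2 * p ≤ m → ∀ c : complexBetti Y (2 * p), IsRationalClass c →
      IsOfHodgeType m Y (2 * p) p p c → c ∈ algebraicClasses Y p)
    (hXHC : HodgeConjectureFor n X) : HodgeConjectureFor m Y :=
  hodgeConjectureFor_of_coverWindow hFul (w := k + 1) hX hY ι (fun p hp ↦ hSom (2 * p) (by omega))
    (fun p _ c₀ h₁ h₂ ↦ hXHC.2 p c₀ h₁ h₂) (fun p h₁ h₂ ↦ hwin p (by omega) h₂)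

/-- **ROW ZL-odd⁻ (odd `m`, one-degree window below the middle closed by a range hypothesis).**
`dim Y = m` odd, `ι^*` bijective on `H²ᵖ` for `2p + 1 < m`, injective on `H^{m-1}` with every rational
`((m-1)/2, (m-1)/2)` class of `Y` a restriction (the 1-ample / Noether–Lefschetz shape one step
below the middle); HC(X) ⇒ HC(Y). -/
theorem hodgeConjectureFor_of_subMiddleWindow_odd (hFul : fulton1998_map_mem_algebraicClasses)
    {m n : ℕ} {X Y : SchemeOver ℂ} (hX : IsSmoothProjective n X) (hY : IsSmoothProjective m Y)
    (ι : Y ⟶ X) (hm : Odd m)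
    (hbij : ∀ p : ℕ, 2 * p + 1 < m → Function.Bijective (complexBetti.map ι (2 * p)))
    (hinj : ∀ p : ℕ, 2 * p + 1 = m → Function.Injective (complexBetti.map ι (2 * p)))
    (hR : ∀ p : ℕ, 2 * p + 1 = m → ∀ c : complexBetti Y (2 * p), IsRationalClass c →
      IsOfHodgeType m Y (2 * p) p p c → c ∈ LinearMap.range (complexBetti.map ι (2 * p)).hom)
    (hXHC : HodgeConjectureFor n X) : HodgeConjectureFor m Y :=
  hodgeConjectureFor_of_coverWindow hFul (w := 2) hX hY ι (fun p hp ↦ hbij p (by omega))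
    (fun p _ c₀ h₁ h₂ ↦ hXHC.2 p c₀ h₁ h₂)
    (fun p h₁ h₂ c hc hpp ↦ by
      have hp : 2 * p + 1 = m := by obtain ⟨j, hj⟩ := hm; omega
      exact mem_algebraicClasses_of_mem_range hFul hX hY ι (hinj p hp) hc hpp (hR p hp c hc hpp)
        (hXHC.2 p))

/-! ### §C `hFul` discharged: unconditional forms for the summit side -/

open Summit.HodgeConjecture.HodgeConjecture.Theorems (fulton1998_map_mem_algebraicClasses_holds)

/-- **CL-LEF1 unconditional: HC(X) ⇒ HC(X ∩ V₊(F))** for every smooth odd-dimensional hypersurface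
section (any degree, any embedding) of a smooth projective `X`. -/
theorem hodgeConjectureFor_hypersurfaceSection_of_odd'
    {m : ℕ} {X : SchemeOver ℂ} (hX : IsSmoothProjective (m + 1) X) (e : ProjectiveEmbedding X)
    {d : ℕ} (hd : 1 ≤ d) (F : MvPolynomial (Fin (e.n + 1)) ℂ) (hF : F.IsHomogeneous d)
    (hY : IsSmoothProjective m (e.hypersurfaceSection F hF)) (hm : Odd m)
    (hHC : HodgeConjectureFor (m + 1) X) :
    HodgeConjectureFor m (e.hypersurfaceSection F hF) :=
  hodgeConjectureFor_hypersurfaceSection_of_odd_of_hodgeConjectureFor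
    fulton1998_map_mem_algebraicClasses_holds hX e hd F hF hY hm hHC

/-- **CL-LEF1 two-step unconditional**: `X` smooth projective of dimension `m + 2` with HC,
`Y₁ = X ∩ V₊(F)` smooth, `Y = Y₁ ∩ V₊(G)` smooth of odd dimension `m` ⇒ HC(Y). -/
theorem hodgeConjectureFor_hypersurfaceSection_twoStep'
    {m : ℕ} {X : SchemeOver ℂ} (hX : IsSmoothProjective (m + 2) X) (e : ProjectiveEmbedding X)
    {d : ℕ} (hd : 1 ≤ d) (F : MvPolynomial (Fin (e.n + 1)) ℂ) (hF : F.IsHomogeneous d)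
    (hY₁ : IsSmoothProjective (m + 1) (e.hypersurfaceSection F hF))
    (e₁ : ProjectiveEmbedding (e.hypersurfaceSection F hF)) {d₁ : ℕ} (hd₁ : 1 ≤ d₁)
    (G : MvPolynomial (Fin (e₁.n + 1)) ℂ) (hG : G.IsHomogeneous d₁)
    (hY : IsSmoothProjective m (e₁.hypersurfaceSection G hG)) (hm : Odd m)
    (hHC : HodgeConjectureFor (m + 2) X) :
    HodgeConjectureFor m (e₁.hypersurfaceSection G hG) :=
  hodgeConjectureFor_hypersurfaceSection_twoStep fulton1998_map_mem_algebraicClasses_holds hX e hd F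
    hF hY₁ e₁ hd₁ G hG hY hm (fun p _ c₀ h₁ h₂ ↦ hHC.2 p c₀ h₁ h₂)

/-- **CL-LEF2 unconditional (consequence form)**: (VG) ∧ HC(X) ⇒ HC(X ∩ V₊(F)) for smooth
even-dimensional sections. -/
theorem hodgeConjectureFor_hypersurfaceSection_of_middle_mem_range'
    {k : ℕ} {X : SchemeOver ℂ} (hX : IsSmoothProjective (2 * k + 1) X) (e : ProjectiveEmbedding X)
    {d : ℕ} (hd : 1 ≤ d) (F : MvPolynomial (Fin (e.n + 1)) ℂ) (hF : F.IsHomogeneous d)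
    (hY : IsSmoothProjective (2 * k) (e.hypersurfaceSection F hF))
    (hVG : ∀ c : complexBetti (e.hypersurfaceSection F hF) (2 * k), IsRationalClass c →
      IsOfHodgeType (2 * k) (e.hypersurfaceSection F hF) (2 * k) k k c →
      c ∈ LinearMap.range (complexBetti.map (e.hypersurfaceSectionι F hF) (2 * k)).hom)
    (hHC : HodgeConjectureFor (2 * k + 1) X) :
    HodgeConjectureFor (2 * k) (e.hypersurfaceSection F hF) :=
  hodgeConjectureFor_hypersurfaceSection_of_middle_mem_range_of_hodgeConjectureFor
    fulton1998_map_mem_algebraicClasses_holds hX e hd F hF hY hVG hHC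

/-- **L7 unconditional**: HC(X) + (VG) for the very general hyperplane section + the Lefschetz package
of the members ⇒ `∀ᶠ H in residual (ℙᴺ)^*(ℂ), X ∩ H smooth → HC(X ∩ H)`. -/
theorem veryGeneralSection_hodgeConjectureFor'
    {k N : ℕ} {X : SchemeOver ℂ} (hX : IsSmoothProjective (2 * k + 1) X)
    (ι : X ⟶ projectiveSpace N ℂ)
    (hVG : VeryGeneralSectionHodgeClassesFromAmbient k N X ι)
    (hLef : UniversalSectionLefschetzPackage k N X ι) (hHC : HodgeConjectureFor (2 * k + 1) X) :
    ∀ᶠ H in residual (ComplexPoints (dualProjectiveSpace N ℂ)),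
      H ∈ universalSmoothLocus N ι (2 * k) →
        HodgeConjectureFor (2 * k) (fiberOver (UniversalHyperplaneSection.proj N ι) H) :=
  veryGeneralSection_hodgeConjectureFor fulton1998_map_mem_algebraicClasses_holds hX ι hVG hLef hHC

/-- **ZL-A unconditional.** -/
theorem hodgeConjectureFor_of_sommesePackage_odd'
    {m n : ℕ} {X Y : SchemeOver ℂ} (hX : IsSmoothProjective n X) (hY : IsSmoothProjective m Y)
    (ι : Y ⟶ X) (hm : Odd m)
    (hSom : ∀ i : ℕ, i < m → Function.Bijective (complexBetti.map ι i))
    (hXHC : HodgeConjectureFor n X) : HodgeConjectureFor m Y :=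
  hodgeConjectureFor_of_sommesePackage_odd fulton1998_map_mem_algebraicClasses_holds hX hY ι hm hSom
    hXHC

/-- **ZL-B(ℙᴺ) unconditional.** -/
theorem hodgeConjectureFor_of_sommesePackage_projectiveSpace_even'
    {k N : ℕ} {Y : SchemeOver ℂ} (hY : IsSmoothProjective (2 * k) Y) (ι : Y ⟶ projectiveSpace N ℂ)
    (hSom : ∀ i : ℕ, i < 2 * k → Function.Bijective (complexBetti.map ι i))
    (hinj : Function.Injective (complexBetti.map ι (2 * k)))
    (hNL : ∀ c : complexBetti Y (2 * k), IsRationalClass c → IsOfHodgeType (2 * k) Y (2 * k) k k c →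
      c ∈ LinearMap.range (complexBetti.map ι (2 * k)).hom) :
    HodgeConjectureFor (2 * k) Y :=
  hodgeConjectureFor_of_sommesePackage_projectiveSpace_even fulton1998_map_mem_algebraicClasses_holds
    hY ι hSom hinj hNL

/-- **Window core unconditional** (covers ZL-W, COV-W and ZL-odd⁻ at once). -/
theorem hodgeConjectureFor_of_coverWindow'
    {m n w : ℕ} {X Y : SchemeOver ℂ} (hX : IsSmoothProjective n X) (hY : IsSmoothProjective m Y)
    (ι : Y ⟶ X)
    (hbij : ∀ p : ℕ, 2 * p + w ≤ m → Function.Bijective (complexBetti.map ι (2 * p)))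
    (hwin : ∀ p : ℕ, m < 2 * p + w → 2 * p ≤ m → ∀ c : complexBetti Y (2 * p), IsRationalClass c →
      IsOfHodgeType m Y (2 * p) p p c → c ∈ algebraicClasses Y p)
    (hXHC : HodgeConjectureFor n X) : HodgeConjectureFor m Y :=
  hodgeConjectureFor_of_coverWindow fulton1998_map_mem_algebraicClasses_holds hX hY ι hbij
    (fun p _ c₀ h₁ h₂ ↦ hXHC.2 p c₀ h₁ h₂) hwin

end Summit.HodgeConjecture.HodgeConjecture.Theorems.LefschetzPackages

end
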